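import Summits.AtomisticToContinuum.HydrodynamicLimit.Theorems.BandCoherenceLDAlongFamilies.Negative.Pathwise
import Summits.AtomisticToContinuum.HydrodynamicLimit.Theorems.BandCoherenceLDAlongFamilies.Negative.Gauss
import Summits.AtomisticToContinuum.HydrodynamicLimit.Theorems.KineticFluxLdDecay.Negative.TiltLowerBound
import Summits.AtomisticToContinuum.HydrodynamicLimit.Theorems.BoltzmannGreenKubo.Negative.TimeAverage
import Summits.AtomisticToContinuum.HydrodynamicLimit.Theorems.BoltzmannGreenKubo.Negative.UniformPhi
import HarnessLib

/-!
# Band-coherence drift witness, III: the Donsker–Varadhan BOOST FLOOR (every flow, every window, every `N`)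

Negative knowledge for the crux `OneFlightGossipEngine.BandCoherenceLDAlongFamilies` (stmt-AtomisticToContinuum-17700):
the dynamic half of the GALILEAN-BOOST witness (refuter-cdisprove-stmt-AtomisticToContinuum-17700-0; the mechanism was found
independently by refuter-rattack-17700-0, whose `Negative/Pathwise.lean` and `Negative/Gauss.lean` are parts I–II, and by
the crux ideators k1/k2). No Theses declaration is mentioned: pure helper theorems, no definitions. The refutation proper
(`¬ BandCoherenceLDAlongFamilies`) is the separate root file `Theorems/OneFlightGossipEngineBandCoherenceLDAlongFamiliesRefutation.lean`.

For the reference homogeneous Gibbs law `G₀` (`a = θ = 1`, `u = 0`) of `N + 1` hard spheres at reduced density `σ ≤ 1/2`,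
EVERY hard-sphere flow `Φ`, every window `w > 0` and the crux's band-coherence functional
`S = Σᵢ 1{η·cubᵢ < ‖q̄ᵢ‖}·cubBandᵢ` with the witness weight `R(s′) = (s′ − k²)·1{k² < s′ ≤ K²}` (`boost_floor`):

  `exp((N+1)·[λ(5D − k²D − k³ − M/K³ − η(1+M)) − D²/2]) ≤ ∫ e^{λS} dG₀`,  `M = E(1+‖ξ‖)⁶`, any `0 ≤ D ≤ 1`, `λ, η ≥ 0`,

by Jensen under the BOOSTED homogeneous Gibbs law `G_D` (drift `D e₀`; tilt identity
`KineticFluxLdDecayTilt.localGibbsMeasure_ref_eq_withDensity`, cost `KL = (N+1)D²/2`): (§3) pathwise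
`S ≥ Σᵢ (q̄ᵢ,₀ − η cubᵢ)` on good data (`BandCoherenceLDNegative.linear_le_summand`); (§2) `G_D` is invariant under every
hard-sphere flow, so window time averages of one-body functions have STATIC expectations
(`BoltzmannGreenKuboOrthMomentum.integral_window_eq`) given by (§1) the one-body marginal `N(De₀, 1)`; (§4) the Gaussian
numbers of part II (`gamma_lower`: linear response `≥ 5D − k²D − k³ − E‖v‖⁶/K³`; `E‖v‖³ ≤ 1 + M`). Linear response versus
quadratic cost: the floor is `> 0` at the crux's fixed tilt for small `η` — uniformly in `τ`, `N` and the dynamics.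

References: S. Olla, S. R. S. Varadhan, H.-T. Yau, Comm. Math. Phys. 155 (1993) §2 (entropy inequality);
H. Spohn, *Large Scale Dynamics of Interacting Particles* (1991), Part I §2.3 (local Gibbs states, Galilean frames).
-/

noncomputable section

open MeasureTheory ProbabilityTheory Set Filter Topology
open scoped ENNReal InnerProductSpace BigOperators

namespace Summit.AtomisticToContinuum.HydrodynamicLimit.Theorems

namespace BandCoherenceLDBoostFloor

open Literature.MathematicalPhysics.KineticTheory Literature.Analysis.FluidPDE
open BandCoherenceLDNegative KineticFluxLdDecayTilt BoltzmannGreenKuboOrthMomentum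

variable {σ : ℝ} {N : ℕ}

/-! ## §1 One-body velocity marginal of a single particle under the homogeneous Gibbs law -/

/-- Under the homogeneous Gibbs measure (constant activity `a > 0`, drift `u`, temperature `θ > 0`, `σ ≤ 1/2`) the
velocity of particle `i` has law `N(u, θ)`. [folklore] -/
theorem measurePreserving_vel_apply (a θ : ℝ) (u : V3) (ha : 0 < a) (hθ : 0 < θ) (hσ2 : σ ≤ 1 / 2) (N : ℕ)
    (i : Fin (N + 1)) :
    MeasurePreserving (fun z : Config (N + 1) (Fin 3) T3 => (z i).2)
      (localGibbsMeasure σ (fun _ => a) (fun _ => u) (fun _ => θ) N) (gaussMeasure u θ) := by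
  have hvelm : Measurable fun z : Config (N + 1) (Fin 3) T3 => fun j => (z j).2 :=
    measurable_pi_lambda _ fun j => (measurable_pi_apply j).snd
  have hmp : MeasurePreserving (fun z : Config (N + 1) (Fin 3) T3 => fun j => (z j).2)
      (localGibbsMeasure σ (fun _ => a) (fun _ => u) (fun _ => θ) N)
      (Measure.pi fun _ : Fin (N + 1) => gaussMeasure u θ) :=
    ⟨hvelm, map_vel_localGibbsMeasure_const σ a θ u ha hθ hσ2 N⟩
  exact (measurePreserving_eval (fun _ : Fin (N + 1) => gaussMeasure u θ) i).comp hmp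

/-- Expectation of a one-body velocity function of particle `i` under the homogeneous Gibbs measure. [folklore] -/
theorem integral_vel_apply (a θ : ℝ) (u : V3) (ha : 0 < a) (hθ : 0 < θ) (hσ2 : σ ≤ 1 / 2) (N : ℕ)
    (i : Fin (N + 1)) {f : V3 → ℝ} (hf : Integrable f (gaussMeasure u θ)) :
    ∫ z, f ((z i).2) ∂localGibbsMeasure σ (fun _ => a) (fun _ => u) (fun _ => θ) N = ∫ v, f v ∂gaussMeasure u θ := by
  have h := measurePreserving_vel_apply a θ u ha hθ hσ2 N i
  have hfm : AEStronglyMeasurable f ((localGibbsMeasure σ (fun _ => a) (fun _ => u) (fun _ => θ) N).map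
      (fun z : Config (N + 1) (Fin 3) T3 => (z i).2)) := by
    rw [h.map_eq]; exact hf.aestronglyMeasurable
  rw [← h.map_eq, integral_map h.measurable.aemeasurable hfm]

/-- Integrability of a one-body velocity function of particle `i` under the homogeneous Gibbs measure. [folklore] -/
theorem integrable_vel_apply (a θ : ℝ) (u : V3) (ha : 0 < a) (hθ : 0 < θ) (hσ2 : σ ≤ 1 / 2) (N : ℕ)
    (i : Fin (N + 1)) {f : V3 → ℝ} (hf : Integrable f (gaussMeasure u θ)) :
    Integrable (fun z : Config (N + 1) (Fin 3) T3 => f ((z i).2))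
      (localGibbsMeasure σ (fun _ => a) (fun _ => u) (fun _ => θ) N) :=
  ((measurePreserving_vel_apply a θ u ha hθ hσ2 N i).integrable_comp hf.aestronglyMeasurable).2 hf

/-! ## §2 Window time averages of one-body velocity functions under the (boosted) homogeneous Gibbs LAW -/

/-- Integrability of the window functional `z ↦ w⁻¹ ∫₀ʷ f(vᵢ(r)) dr` under the homogeneous Gibbs law with drift `u`
(any hard-sphere flow; Fubini + stationarity, `BoltzmannGreenKuboOrthMomentum.integrable_window`). [folklore] -/
theorem integrable_window_vel (u : V3) (hσ2 : σ ≤ 1 / 2)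
    (Φ : HardSphereFlow (Torus.geometry (Fin 3)) (hsDiameter σ N) (N + 1)) (i : Fin (N + 1))
    {f : V3 → ℝ} (hfm : Measurable f) (hf : Integrable f (gaussMeasure u 1)) {w : ℝ} (hw : 0 < w) :
    Integrable (fun z => w⁻¹ * ∫ r in (0 : ℝ)..w, f ((Φ.flow r z i).2))
      (localGibbsLaw σ (fun _ => 1) (fun _ => u) (fun _ => 1) N Φ) := by
  haveI : IsProbabilityMeasure (localGibbsLaw σ (fun _ => 1) (fun _ => u) (fun _ => 1) N Φ) :=
    isProbabilityMeasure_localGibbsLaw continuous_const continuous_const continuous_const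
      (fun _ => one_pos) (fun _ => one_pos) hσ2 N Φ
  have hX : Measurable fun y : Config (N + 1) (Fin 3) T3 => f ((y i).2) := hfm.comp (measurable_pi_apply i).snd
  have hXi : Integrable (fun y : Config (N + 1) (Fin 3) T3 => f ((y i).2))
      (localGibbsLaw σ (fun _ => 1) (fun _ => u) (fun _ => 1) N Φ) := by
    rw [localGibbsLaw_eq]; exact integrable_vel_apply 1 1 u one_pos one_pos hσ2 N i hf
  exact (integrable_window 1 1 u Φ (X := fun y => f ((y i).2)) hX hXi hw.le).const_mul w⁻¹

/-- **Window time averages have static expectations**: `∫ w⁻¹∫₀ʷ f(vᵢ(r)) dr dG_u = ∫ f dN(u, 1)` for every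
hard-sphere flow (invariance of the homogeneous Gibbs law + one-body marginal). [folklore] -/
theorem integral_window_vel (u : V3) (hσ2 : σ ≤ 1 / 2)
    (Φ : HardSphereFlow (Torus.geometry (Fin 3)) (hsDiameter σ N) (N + 1)) (i : Fin (N + 1))
    {f : V3 → ℝ} (hfm : Measurable f) (hf : Integrable f (gaussMeasure u 1)) {w : ℝ} (hw : 0 < w) :
    ∫ z, (w⁻¹ * ∫ r in (0 : ℝ)..w, f ((Φ.flow r z i).2)) ∂(localGibbsLaw σ (fun _ => 1) (fun _ => u) (fun _ => 1) N Φ) =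
      ∫ v, f v ∂gaussMeasure u 1 := by
  haveI : IsProbabilityMeasure (localGibbsLaw σ (fun _ => 1) (fun _ => u) (fun _ => 1) N Φ) :=
    isProbabilityMeasure_localGibbsLaw continuous_const continuous_const continuous_const
      (fun _ => one_pos) (fun _ => one_pos) hσ2 N Φ
  have hX : Measurable fun y : Config (N + 1) (Fin 3) T3 => f ((y i).2) := hfm.comp (measurable_pi_apply i).snd
  have hXi : Integrable (fun y : Config (N + 1) (Fin 3) T3 => f ((y i).2))
      (localGibbsLaw σ (fun _ => 1) (fun _ => u) (fun _ => 1) N Φ) := by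
    rw [localGibbsLaw_eq]; exact integrable_vel_apply 1 1 u one_pos one_pos hσ2 N i hf
  rw [integral_const_mul, integral_window_eq 1 1 u Φ (X := fun y => f ((y i).2)) hX hXi hw.le, ← mul_assoc,
    inv_mul_cancel₀ hw.ne', one_mul, localGibbsLaw_eq, integral_vel_apply 1 1 u one_pos one_pos hσ2 N i hf]

/-! ## §3 Pathwise: the coherence functional dominates the linear functional (good data; time-measurability of good
orbits is `BoltzmannGreenKuboUniformPhi.measurable_orbit`) -/

/-- **`S ≥ Σᵢ (q̄ᵢ,₀ − η·cubᵢ)`** along every time-measurable orbit (sum of `linear_le_summand`). [folklore] -/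
theorem linear_sum_le (Φ : HardSphereFlow (Torus.geometry (Fin 3)) (hsDiameter σ N) (N + 1))
    {z : Config (N + 1) (Fin 3) T3} (hzm : Measurable fun r : ℝ => Φ.flow r z) {w k K η : ℝ} (hw : 0 < w)
    (hk : 0 ≤ k) (hK : 0 ≤ K) (hη : 0 ≤ η) :
    ∑ i : Fin (N + 1), (w⁻¹ * (∫ r in (0 : ℝ)..w, (if k ^ 2 < ‖(Φ.flow r z i).2‖ ^ 2 ∧ ‖(Φ.flow r z i).2‖ ^ 2 ≤ K ^ 2
        then ‖(Φ.flow r z i).2‖ ^ 2 - k ^ 2 else 0) * (Φ.flow r z i).2 0) -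
        η * (w⁻¹ * ∫ r in (0 : ℝ)..w, ‖(Φ.flow r z i).2‖ ^ 3)) ≤
      ∑ i : Fin (N + 1), (if η * (w⁻¹ * ∫ r in (0 : ℝ)..w, ‖(Φ.flow r z i).2‖ ^ 3) <
          ‖w⁻¹ • ∫ r in (0 : ℝ)..w, (if k ^ 2 < ‖(Φ.flow r z i).2‖ ^ 2 ∧ ‖(Φ.flow r z i).2‖ ^ 2 ≤ K ^ 2
            then ‖(Φ.flow r z i).2‖ ^ 2 - k ^ 2 else 0) • (Φ.flow r z i).2‖ then
        w⁻¹ * ∫ r in (0 : ℝ)..w, (if k < ‖(Φ.flow r z i).2‖ ∧ ‖(Φ.flow r z i).2‖ ≤ K then ‖(Φ.flow r z i).2‖ ^ 3 else 0)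
        else 0) :=
  Finset.sum_le_sum fun i _ =>
    linear_le_summand (W := fun r => (Φ.flow r z i).2) hw hk hK hη ((measurable_pi_apply i).comp hzm).snd

/-! ## §4 The Donsker–Varadhan floor with an invariant boosted Gibbs law -/

/-- **The boost floor, general drift.** For the reference homogeneous Gibbs law `G₀` (`a = θ = 1`, `u = 0`), EVERY
hard-sphere flow `Φ`, every window `w > 0`, `0 ≤ k`, `0 ≤ K`, `η ≥ 0`, tilt `λ ≥ 0` and drift `u`:
`exp((N+1)·[λ(γ(u) − η C₃(u)) + ∫ llr1 dN(u,1)]) ≤ ∫ e^{λ S} dG₀`, where `γ(u) = E_{N(u,1)} R(‖v‖²)v₀`,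
`C₃(u) = E_{N(u,1)}‖v‖³`, `∫ llr1 dN(u,1) = −KL(N(u,1)‖N(0,1)) = −‖u‖²/2`, and `S` is the crux's band-coherence
functional (constant family, `u₀ = 0`, the witness weight). Jensen under `G_u = G₀·e^{−llr}` (tilt identity),
invariance of `G_u` under the flow, one-body marginals. [folklore] -/
theorem floor_general (hσ2 : σ ≤ 1 / 2) (N : ℕ)
    (Φ : HardSphereFlow (Torus.geometry (Fin 3)) (hsDiameter σ N) (N + 1)) (u : V3)
    {k K η lam w : ℝ} (hk : 0 ≤ k) (hK : 0 ≤ K) (hη : 0 ≤ η) (hlam : 0 ≤ lam) (hw : 0 < w) :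
    ENNReal.ofReal (Real.exp (((N : ℝ) + 1) *
        (lam * ((∫ v, (if k ^ 2 < ‖v‖ ^ 2 ∧ ‖v‖ ^ 2 ≤ K ^ 2 then ‖v‖ ^ 2 - k ^ 2 else 0) * v 0 ∂gaussMeasure u 1) -
            η * ∫ v, ‖v‖ ^ 3 ∂gaussMeasure u 1) + ∫ v, llr1 1 u v ∂gaussMeasure u 1))) ≤
      ∫⁻ z, ENNReal.ofReal (Real.exp (lam * ∑ i : Fin (N + 1),
          (if η * (w⁻¹ * ∫ r in (0 : ℝ)..w, ‖(Φ.flow r z i).2‖ ^ 3) <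
              ‖w⁻¹ • ∫ r in (0 : ℝ)..w, (if k ^ 2 < ‖(Φ.flow r z i).2‖ ^ 2 ∧ ‖(Φ.flow r z i).2‖ ^ 2 ≤ K ^ 2
                then ‖(Φ.flow r z i).2‖ ^ 2 - k ^ 2 else 0) • (Φ.flow r z i).2‖ then
            w⁻¹ * ∫ r in (0 : ℝ)..w,
              (if k < ‖(Φ.flow r z i).2‖ ∧ ‖(Φ.flow r z i).2‖ ≤ K then ‖(Φ.flow r z i).2‖ ^ 3 else 0)
            else 0)))
        ∂(localGibbsLaw σ (fun _ => 1) (fun _ => 0) (fun _ => 1) N Φ) := by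
  -- the crux functional `S`, the linear functional `L`, the boosted law `GD`
  set S : Config (N + 1) (Fin 3) T3 → ℝ := fun z => ∑ i : Fin (N + 1),
      (if η * (w⁻¹ * ∫ r in (0 : ℝ)..w, ‖(Φ.flow r z i).2‖ ^ 3) <
          ‖w⁻¹ • ∫ r in (0 : ℝ)..w, (if k ^ 2 < ‖(Φ.flow r z i).2‖ ^ 2 ∧ ‖(Φ.flow r z i).2‖ ^ 2 ≤ K ^ 2
            then ‖(Φ.flow r z i).2‖ ^ 2 - k ^ 2 else 0) • (Φ.flow r z i).2‖ then
        w⁻¹ * ∫ r in (0 : ℝ)..w,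
          (if k < ‖(Φ.flow r z i).2‖ ∧ ‖(Φ.flow r z i).2‖ ≤ K then ‖(Φ.flow r z i).2‖ ^ 3 else 0)
        else 0) with hS
  set g : V3 → ℝ := fun v => (if k ^ 2 < ‖v‖ ^ 2 ∧ ‖v‖ ^ 2 ≤ K ^ 2 then ‖v‖ ^ 2 - k ^ 2 else 0) * v 0 with hg
  set Q : Fin (N + 1) → Config (N + 1) (Fin 3) T3 → ℝ := fun i z =>
      w⁻¹ * ∫ r in (0 : ℝ)..w, g ((Φ.flow r z i).2) with hQ
  set C : Fin (N + 1) → Config (N + 1) (Fin 3) T3 → ℝ := fun i z =>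
      w⁻¹ * ∫ r in (0 : ℝ)..w, ‖(Φ.flow r z i).2‖ ^ 3 with hC
  set L : Config (N + 1) (Fin 3) T3 → ℝ := fun z => ∑ i : Fin (N + 1), (Q i z - η * C i z) with hL
  set G0 := localGibbsLaw σ (fun _ => 1) (fun _ => 0) (fun _ => 1) N Φ with hG0
  set GD := localGibbsLaw σ (fun _ => 1) (fun _ => u) (fun _ => 1) N Φ with hGD
  haveI : IsProbabilityMeasure GD :=
    isProbabilityMeasure_localGibbsLaw continuous_const continuous_const continuous_const
      (fun _ => one_pos) (fun _ => one_pos) hσ2 N Φ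
  -- one-body inputs
  have hgm : Measurable g :=
    ((measurable_Rrad k K).comp (measurable_norm.pow_const 2)).mul (EuclideanSpace.proj (𝕜 := ℝ) (0 : Fin 3)).measurable
  have hgi : Integrable g (gaussMeasure u 1) :=
    Integrable.of_bound hgm.aestronglyMeasurable (K ^ 3)
      (ae_of_all _ fun v => by rw [Real.norm_eq_abs]; exact abs_Rrad_mul_coord_le hk hK v)
  have hcm : Measurable fun v : V3 => ‖v‖ ^ 3 := measurable_norm.pow_const 3
  have hci : Integrable (fun v : V3 => ‖v‖ ^ 3) (gaussMeasure u 1) := by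
    simpa using (IsGaussian.memLp_id (gaussMeasure u 1) 3 (ENNReal.natCast_ne_top 3)).integrable_norm_pow'
  -- integrability and expectations of the window functionals under `GD`
  have hQi : ∀ i, Integrable (Q i) GD := fun i => integrable_window_vel u hσ2 Φ i hgm hgi hw
  have hCi : ∀ i, Integrable (C i) GD := fun i =>
    integrable_window_vel u hσ2 Φ i (f := fun v : V3 => ‖v‖ ^ 3) hcm hci hw
  have hQe : ∀ i, ∫ z, Q i z ∂GD = ∫ v, g v ∂gaussMeasure u 1 := fun i => integral_window_vel u hσ2 Φ i hgm hgi hw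
  have hCe : ∀ i, ∫ z, C i z ∂GD = ∫ v, ‖v‖ ^ 3 ∂gaussMeasure u 1 := fun i =>
    integral_window_vel u hσ2 Φ i (f := fun v : V3 => ‖v‖ ^ 3) hcm hci hw
  have hLi : Integrable L GD :=
    integrable_finsetSum (f := fun i z => Q i z - η * C i z) Finset.univ fun i _ => (hQi i).sub ((hCi i).const_mul η)
  have hLe : ∫ z, L z ∂GD = ((N : ℝ) + 1) * ((∫ v, g v ∂gaussMeasure u 1) - η * ∫ v, ‖v‖ ^ 3 ∂gaussMeasure u 1) := by
    have h1 : ∫ z, L z ∂GD = ∑ i : Fin (N + 1), ∫ z, (Q i z - η * C i z) ∂GD :=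
      integral_finsetSum (f := fun i z => Q i z - η * C i z) Finset.univ fun i _ => (hQi i).sub ((hCi i).const_mul η)
    have h2 : ∀ i : Fin (N + 1), ∫ z, (Q i z - η * C i z) ∂GD =
        (∫ v, g v ∂gaussMeasure u 1) - η * ∫ v, ‖v‖ ^ 3 ∂gaussMeasure u 1 := fun i => by
      rw [integral_sub (hQi i) ((hCi i).const_mul η), hQe i, integral_const_mul, hCe i]
    rw [h1, Finset.sum_congr rfl fun i _ => h2 i, Finset.sum_const, Finset.card_univ, Fintype.card_fin, nsmul_eq_mul]
    push_cast
    ring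
  -- the log-likelihood ratio
  have hlli : Integrable (llrConfig 1 u : Config (N + 1) (Fin 3) T3 → ℝ) GD := by
    rw [hGD, localGibbsLaw_eq]
    exact integrable_sum_vel_localGibbsMeasure_const σ 1 1 u one_pos one_pos hσ2 N (integrable_llr1 one_pos u)
  have hlle : ∫ z, llrConfig 1 u z ∂GD = ((N : ℝ) + 1) * ∫ v, llr1 1 u v ∂gaussMeasure u 1 := by
    rw [hGD, localGibbsLaw_eq]
    have h := integral_sum_vel_localGibbsMeasure_const σ 1 1 u one_pos one_pos hσ2 N (integrable_llr1 one_pos u)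
    unfold llrConfig
    rw [h]
    push_cast
    ring
  -- the tilt identity `G0 = GD · e^{llr}`
  have htilt : G0 = GD.withDensity (fun z => ENNReal.ofReal (Real.exp (llrConfig 1 u z))) := by
    rw [hG0, hGD, localGibbsLaw_eq, localGibbsLaw_eq, localGibbsMeasure_ref_eq_withDensity σ one_pos u N]
  have hfm : Measurable fun z : Config (N + 1) (Fin 3) T3 => ENNReal.ofReal (Real.exp (llrConfig 1 u z)) :=
    (measurable_llrConfig one_pos u (N + 1)).exp.ennreal_ofReal
  -- Jensen's exponent
  set Y : Config (N + 1) (Fin 3) T3 → ℝ := fun z => lam * L z + llrConfig 1 u z with hY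
  have hYi : Integrable Y GD := (hLi.const_mul lam).add hlli
  have hYe : ∫ z, Y z ∂GD = ((N : ℝ) + 1) *
      (lam * ((∫ v, g v ∂gaussMeasure u 1) - η * ∫ v, ‖v‖ ^ 3 ∂gaussMeasure u 1) + ∫ v, llr1 1 u v ∂gaussMeasure u 1) := by
    rw [hY, integral_add (hLi.const_mul lam) hlli, integral_const_mul, hLe, hlle]
    ring
  -- a.e. pathwise domination `Y ≤ lam·S + llr`
  have hae : ∀ᵐ z ∂GD, ENNReal.ofReal (Real.exp (Y z)) ≤
      ENNReal.ofReal (Real.exp (llrConfig 1 u z)) * ENNReal.ofReal (Real.exp (lam * S z)) := by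
    filter_upwards [ae_mem_good_localGibbsLaw' (σ := σ) (N := N) 1 1 u Φ] with z hz
    have hLS : L z ≤ S z := linear_sum_le Φ (BoltzmannGreenKuboUniformPhi.measurable_orbit Φ hz) hw hk hK hη
    have h1 : lam * L z ≤ lam * S z := mul_le_mul_of_nonneg_left hLS hlam
    show ENNReal.ofReal (Real.exp (lam * L z + llrConfig 1 u z)) ≤
      ENNReal.ofReal (Real.exp (llrConfig 1 u z)) * ENNReal.ofReal (Real.exp (lam * S z))
    rw [← ENNReal.ofReal_mul (Real.exp_pos _).le, ← Real.exp_add]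
    exact ENNReal.ofReal_le_ofReal (Real.exp_le_exp.2 (by linarith))
  calc ENNReal.ofReal (Real.exp (((N : ℝ) + 1) *
        (lam * ((∫ v, g v ∂gaussMeasure u 1) - η * ∫ v, ‖v‖ ^ 3 ∂gaussMeasure u 1) + ∫ v, llr1 1 u v ∂gaussMeasure u 1)))
      = ENNReal.ofReal (Real.exp (∫ z, Y z ∂GD)) := by rw [hYe]
    _ ≤ ∫⁻ z, ENNReal.ofReal (Real.exp (Y z)) ∂GD := ofReal_exp_integral_le_lintegral GD hYi
    _ ≤ ∫⁻ z, ENNReal.ofReal (Real.exp (llrConfig 1 u z)) * ENNReal.ofReal (Real.exp (lam * S z)) ∂GD :=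
        lintegral_mono_ae hae
    _ = ∫⁻ z, ENNReal.ofReal (Real.exp (lam * S z)) ∂G0 := by
        rw [htilt, lintegral_withDensity_eq_lintegral_mul_non_measurable _ hfm
          (ae_of_all _ fun z => ENNReal.ofReal_lt_top)]
        rfl

/-- **The boost floor** at drift `D e₀`, `0 ≤ D ≤ 1`, with the Gaussian numbers of `Negative/Gauss.lean`
(`M = E(1 + ‖ξ‖)⁶`): `exp((N+1)·[λ(5D − k²D − k³ − M/K³ − η(1+M)) − D²/2]) ≤ ∫ e^{λS} dG₀`, for EVERY hard-sphere
flow, window and `N`. [folklore] -/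
theorem boost_floor (hσ2 : σ ≤ 1 / 2) (N : ℕ)
    (Φ : HardSphereFlow (Torus.geometry (Fin 3)) (hsDiameter σ N) (N + 1))
    {k K D η lam w : ℝ} (hk : 0 ≤ k) (hkK : k ≤ K) (hK : 0 < K) (hD0 : 0 ≤ D) (hD1 : D ≤ 1) (hη : 0 ≤ η)
    (hlam : 0 ≤ lam) (hw : 0 < w) :
    ENNReal.ofReal (Real.exp (((N : ℝ) + 1) *
        (lam * (5 * D - k ^ 2 * D - k ^ 3 - (∫ w, (1 + ‖w‖) ^ 6 ∂stdGaussian V3) / K ^ 3 -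
            η * (1 + ∫ w, (1 + ‖w‖) ^ 6 ∂stdGaussian V3)) - D ^ 2 / 2))) ≤
      ∫⁻ z, ENNReal.ofReal (Real.exp (lam * ∑ i : Fin (N + 1),
          (if η * (w⁻¹ * ∫ r in (0 : ℝ)..w, ‖(Φ.flow r z i).2‖ ^ 3) <
              ‖w⁻¹ • ∫ r in (0 : ℝ)..w, (if k ^ 2 < ‖(Φ.flow r z i).2‖ ^ 2 ∧ ‖(Φ.flow r z i).2‖ ^ 2 ≤ K ^ 2
                then ‖(Φ.flow r z i).2‖ ^ 2 - k ^ 2 else 0) • (Φ.flow r z i).2‖ then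
            w⁻¹ * ∫ r in (0 : ℝ)..w,
              (if k < ‖(Φ.flow r z i).2‖ ∧ ‖(Φ.flow r z i).2‖ ≤ K then ‖(Φ.flow r z i).2‖ ^ 3 else 0)
            else 0)))
        ∂(localGibbsLaw σ (fun _ => 1) (fun _ => 0) (fun _ => 1) N Φ) := by
  have key := floor_general hσ2 N Φ (D • (EuclideanSpace.single (0 : Fin 3) (1 : ℝ) : V3)) hk hK.le hη hlam hw
    (lam := lam)
  refine le_trans (ENNReal.ofReal_le_ofReal (Real.exp_le_exp.2 ?_)) key
  -- the Gaussian numbers at drift `D e₀`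
  have hγ := gamma_lower hD0 hk hkK hK
  have h6 := integral_norm_pow_six_gaussD_le hD0 hD1
  have h3 := integral_norm_pow_three_gaussD_le hD0 hD1
  have hllr : ∫ v, llr1 1 (D • (EuclideanSpace.single (0 : Fin 3) (1 : ℝ) : V3)) v
      ∂gaussMeasure (D • (EuclideanSpace.single (0 : Fin 3) (1 : ℝ) : V3)) 1 = -(D ^ 2 / 2) := by
    have hfun : (fun v : V3 => llr1 1 (D • (EuclideanSpace.single (0 : Fin 3) (1 : ℝ) : V3)) v) =
        fun v : V3 => D ^ 2 / 2 - D * v 0 := by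
      funext v
      rw [llr1_eq one_pos, Real.log_one, mul_zero, zero_sub, mul_one, norm_sub_sq_real, inner_smul_e0_right,
        norm_smul_e0_sq]
      ring
    have i1 : Integrable (fun v : V3 => v 0) (gaussMeasure (D • (EuclideanSpace.single (0 : Fin 3) (1 : ℝ) : V3)) 1) :=
      memLp_one_iff_integrable.1 (memLp_coord_gaussMeasure (D • (EuclideanSpace.single (0 : Fin 3) (1 : ℝ) : V3)) 1 0 1 (by simp))
    rw [hfun, integral_sub (integrable_const _) (i1.const_mul D), integral_const_mul, integral_coord_gaussD, integral_const]
    simp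
    ring
  rw [hllr]
  have hK3 : 0 < K ^ 3 := pow_pos hK 3
  have hdiv : (∫ v, ‖v‖ ^ 6 ∂gaussMeasure (D • (EuclideanSpace.single (0 : Fin 3) (1 : ℝ) : V3)) 1) / K ^ 3 ≤
      (∫ w, (1 + ‖w‖) ^ 6 ∂stdGaussian V3) / K ^ 3 := div_le_div_of_nonneg_right h6 hK3.le
  have hN : (0 : ℝ) ≤ (N : ℝ) + 1 := by positivity
  have hinner : lam * (5 * D - k ^ 2 * D - k ^ 3 - (∫ w, (1 + ‖w‖) ^ 6 ∂stdGaussian V3) / K ^ 3 -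
        η * (1 + ∫ w, (1 + ‖w‖) ^ 6 ∂stdGaussian V3)) - D ^ 2 / 2 ≤
      lam * ((∫ v, (if k ^ 2 < ‖v‖ ^ 2 ∧ ‖v‖ ^ 2 ≤ K ^ 2 then ‖v‖ ^ 2 - k ^ 2 else 0) * v 0
          ∂gaussMeasure (D • (EuclideanSpace.single (0 : Fin 3) (1 : ℝ) : V3)) 1) -
        η * ∫ v, ‖v‖ ^ 3 ∂gaussMeasure (D • (EuclideanSpace.single (0 : Fin 3) (1 : ℝ) : V3)) 1) + -(D ^ 2 / 2) := by
    have hA : 5 * D - k ^ 2 * D - k ^ 3 - (∫ w, (1 + ‖w‖) ^ 6 ∂stdGaussian V3) / K ^ 3 -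
          η * (1 + ∫ w, (1 + ‖w‖) ^ 6 ∂stdGaussian V3) ≤
        (∫ v, (if k ^ 2 < ‖v‖ ^ 2 ∧ ‖v‖ ^ 2 ≤ K ^ 2 then ‖v‖ ^ 2 - k ^ 2 else 0) * v 0
            ∂gaussMeasure (D • (EuclideanSpace.single (0 : Fin 3) (1 : ℝ) : V3)) 1) -
          η * ∫ v, ‖v‖ ^ 3 ∂gaussMeasure (D • (EuclideanSpace.single (0 : Fin 3) (1 : ℝ) : V3)) 1 := by
      nlinarith [mul_le_mul_of_nonneg_left h3 hη]
    nlinarith [mul_le_mul_of_nonneg_left hA hlam]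
  exact mul_le_mul_of_nonneg_left hinner hN

end BandCoherenceLDBoostFloor

end Summit.AtomisticToContinuum.HydrodynamicLimit.Theorems

end
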